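import Summits.CriticalPhenomena.PercolationContinuityZ3.Theorems.Transplant.FKConnectivityAllQApexConn
import HarnessLib

/-!
# Connectivity correlation inequalities for `φ_{w,q}`, every `q > 0` — file 9g: apex elimination, CLOSED FORMS ON ONE APEX
# (the 'triangle level': masses of `z ↔ t`, `z ↔ y`, `Ω`, `{z ↔ y} ∖ {z ↔ t}` for an apex `y` over `(z,t)`)

Support file (`--supports stmt-CriticalPhenomena-4575`), FK sub-lane `prim-bschramm-fk-1` (gen 5) of the post-continuity
programme; builds on p205010 (kernel theorem, internal audit signed; external expert review pending).  No definitions, no named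
facts, no sorries; standard axioms.

THE `K₄` COMPUTATION (files `…ApexTriangle`, `…ApexDiamond`, `…DiamondCertificates`, `…K4`).  Wagner (Ann. Comb. 2008, Ex. 5.1)
reports an unpublished computation of A. Sokal (2005) that the Potts model of `K₄` is Rayleigh for all `0 < q ≤ 1`, i.e. `φ_{w,q}` on
`K₄` is edge-negatively associated for every weight vector.  We certify it in the kernel: by fk-2's master identity, negative
association of the pair `xy` with `f` on `K₄` is EC⁺ for `x ↔ y` in the diamond `K₄ − xy` (tips `x, y`, base pair `zt`), in which
`y` is an apex over `(z,t)` and `x` a second apex over `(z,t)`; two rounds of the apex identities express `S_w(x ↔ y)` and `Z_w` as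
explicit polynomials in the five parameters, `r = q⁻¹` and the two base masses `A = S°°(z ↔ t)`, `B = S°°(z ↮ t)`
(`dia_closed_forms`); the three EC⁺ comparisons (`f` = side pair `zx`, tip pair `zy`, base pair `zt`; the other two by the
`z ↔ t` symmetry) are then polynomial inequalities, each closed by an explicit nonnegativity certificate in Bernstein form
(products of `w_e`, `1 − w_e`, `r − 1`, `A`, `B` with positive coefficients, plus one square for the base pair) found by computer
algebra and checked by `ring`.

THIS FILE: the `u ↔ v` mirror symmetry of the apex data (`apexAvoid_swap`, `apexDead_swap`, `apex_hyp_swap`), and for an apex `y`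
over `(z,t)` with `c = zy`, `d = yt`, `K = {z ↔ t avoiding c,d}`, `A = S°(K)`, `B = S°(Kᶜ)`: `tri_mass_univ` (`Z_w`), `tri_mass_zt`
(`S_w(z ↔ t) = αA + w_cw_d r² B`), `tri_mass_zy`, `tri_mass_zy_not_zt` (`S_w(z ↔ y, z ↮ t) = w_c(1−w_d) r B`).
[cite: Grimmett2006, Thm. (3.1)(a) (p. 37); §1.4 eq. (1.20) (p. 15)] [cite: Wagner2006, Ex. 5.1]
-/

noncomputable section

namespace Summit.CriticalPhenomena.PercolationContinuityZ3.Theorems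

namespace FK

open MeasureTheory Set Literature.Probability.LatticeModels Literature.Probability.Percolation
open Literature.Probability.Percolation.DecisionTree (ind ind_of_mem ind_of_not_mem ind_nonneg)
open Literature.Probability.Percolation.TwoAvoidanceSets (ind_mul_ind)
open scoped Classical symmDiff

variable {V : Type*} [Fintype V]

/-! ### Mirror symmetry `u ↔ v` of the apex data -/

omit [Fintype V] in
/-- The apex-avoiding connection event is symmetric in `u, v`. [folklore] -/
theorem apexAvoid_swap (u v x : V) :
    {ω : BondConfig V | ω \ {s(v, x), s(x, u)} ∈ (openConn v u : Set (BondConfig V))} =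
      {ω : BondConfig V | ω \ {s(u, x), s(x, v)} ∈ (openConn u v : Set (BondConfig V))} := by
  ext ω
  simp only [Set.mem_setOf_eq]
  rw [Sym2.eq_swap (a := v) (b := x), Sym2.eq_swap (a := x) (b := u), Set.pair_comm, openConn_comm]

omit [Fintype V] in
/-- The apex-deleted vector is symmetric in `u, v`. [folklore] -/
theorem apexDead_swap (w : Sym2 V → unitInterval) {u v x : V} (hxu : x ≠ u) (huv : u ≠ v) :
    Function.update (Function.update w s(v, x) 0) s(x, u) 0 = Function.update (Function.update w s(u, x) 0) s(x, v) 0 := by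
  rw [Sym2.eq_swap (a := v) (b := x), Sym2.eq_swap (a := x) (b := u), Function.update_comm (apex_pairs_ne hxu huv).symm]

omit [Fintype V] in
/-- The apex hypothesis is symmetric in `u, v`. [folklore] -/
theorem apex_hyp_swap {w : Sym2 V → unitInterval} {u v x : V}
    (hw : ∀ e : Sym2 V, x ∈ e → ((w e : unitInterval) : ℝ) ≠ 0 → u ∈ e ∨ v ∈ e) :
    ∀ e : Sym2 V, x ∈ e → ((w e : unitInterval) : ℝ) ≠ 0 → v ∈ e ∨ u ∈ e := fun e h1 h2 => (hw e h1 h2).symm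

/-- With both apex pairs dead, almost surely removing them changes nothing. [cite: Grimmett2006, §1.4 eq. (1.20) (p. 15)] -/
theorem diff_apex_eq_self_ae (w : Sym2 V → unitInterval) (q : ℝ) {u v x : V}
    (ha : ((w s(u, x) : unitInterval) : ℝ) = 0) (hb : ((w s(x, v) : unitInterval) : ℝ) = 0)
    {ω : BondConfig V} (hω : rcWeightW w q ∅ ω ≠ 0) : ω \ {s(u, x), s(x, v)} = ω := by
  rw [sdiff_eq_left, Set.disjoint_left]
  intro e he hepair
  rcases hepair with rfl | rfl
  · exact not_mem_of_rcWeightW_ne_zero w q ha hω he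
  · exact not_mem_of_rcWeightW_ne_zero w q hb hω he

/-! ### Closed forms on one apex over a base pair (the 'triangle level'): masses of `z ↔ t`, `z ↔ y`, `Ω`, and of
`{z ↔ y} ∖ {z ↔ t}`, `{z ↔ y} ∩ {z ↔ t}` for an apex `y` over `(z, t)`, in terms of `A = S°(K)`, `B = S°(Kᶜ)` -/

/-- **Triangle level, `Ω`**: `Z_w = ((1−w_c)+w_c q⁻¹)((1−w_d)+w_d q⁻¹)(A + B) − w_c w_d q⁻¹(q⁻¹−1)·A` for an apex `y` over `(z,t)`
(`c = zy`, `d = yt`, `A = S°(K)`, `B = S°(Kᶜ)`). [cite: Grimmett2006, Thm. (3.1)(a) (p. 37); §1.4 eq. (1.20) (p. 15)] -/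
theorem tri_mass_univ (w : Sym2 V → unitInterval) {q : ℝ} (hq : q ≠ 0) {z t y : V} (hyz : y ≠ z) (hyt : y ≠ t) (hzt : z ≠ t)
    (hw : ∀ e : Sym2 V, y ∈ e → ((w e : unitInterval) : ℝ) ≠ 0 → z ∈ e ∨ t ∈ e) :
    rcPartitionFunctionW w q ∅ =
      ((1 - ((w s(z, y) : unitInterval) : ℝ)) + ((w s(z, y) : unitInterval) : ℝ) * q⁻¹) *
          ((1 - ((w s(y, t) : unitInterval) : ℝ)) + ((w s(y, t) : unitInterval) : ℝ) * q⁻¹) *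
          (∑ ω : BondConfig V, rcWeightW (Function.update (Function.update w s(z, y) 0) s(y, t) 0) q ∅ ω *
              ind {ω : BondConfig V | ω \ {s(z, y), s(y, t)} ∈ (openConn z t : Set (BondConfig V))} ω +
            ∑ ω : BondConfig V, rcWeightW (Function.update (Function.update w s(z, y) 0) s(y, t) 0) q ∅ ω *
              ind {ω : BondConfig V | ω \ {s(z, y), s(y, t)} ∈ (openConn z t : Set (BondConfig V))}ᶜ ω) -
        ((w s(z, y) : unitInterval) : ℝ) * ((w s(y, t) : unitInterval) : ℝ) * q⁻¹ * (q⁻¹ - 1) *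
          ∑ ω : BondConfig V, rcWeightW (Function.update (Function.update w s(z, y) 0) s(y, t) 0) q ∅ ω *
            ind {ω : BondConfig V | ω \ {s(z, y), s(y, t)} ∈ (openConn z t : Set (BondConfig V))} ω := by
  have hU : ∀ g : Sym2 V, ∀ ω : BondConfig V, ω ∆ {g} ∈ (Set.univ : Set (BondConfig V)) ↔ ω ∈ (Set.univ : Set (BondConfig V)) :=
    fun g ω => by simp
  have h := apex_mass w hq hyz hyt hzt hw Set.univ (hU _) (hU _)
  rw [sum_rcWeightW_ind_univ, sum_rcWeightW_ind_univ, Set.univ_inter] at h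
  rw [h, ← sum_rcWeightW_ind_univ (Function.update (Function.update w s(z, y) 0) s(y, t) 0) q,
    sum_rcWeightW_ind_compl, sum_rcWeightW_ind_univ]
  ring

/-- **Triangle level, `z ↔ t`**: `S_w(z ↔ t) = α·A + w_c w_d q⁻²·B` with `α = (1−w_c)(1−w_d) + (w_c+w_d−w_cw_d)q⁻¹`.
[cite: Grimmett2006, Thm. (3.1)(a) (p. 37); §1.4 eq. (1.20) (p. 15)] -/
theorem tri_mass_zt (w : Sym2 V → unitInterval) {q : ℝ} (hq : q ≠ 0) {z t y : V} (hyz : y ≠ z) (hyt : y ≠ t) (hzt : z ≠ t)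
    (hw : ∀ e : Sym2 V, y ∈ e → ((w e : unitInterval) : ℝ) ≠ 0 → z ∈ e ∨ t ∈ e) :
    ∑ ω : BondConfig V, rcWeightW w q ∅ ω * ind (openConn z t : Set (BondConfig V)) ω =
      ((1 - ((w s(z, y) : unitInterval) : ℝ)) * (1 - ((w s(y, t) : unitInterval) : ℝ)) +
            (((w s(z, y) : unitInterval) : ℝ) + ((w s(y, t) : unitInterval) : ℝ) -
              ((w s(z, y) : unitInterval) : ℝ) * ((w s(y, t) : unitInterval) : ℝ)) * q⁻¹) *
          ∑ ω : BondConfig V, rcWeightW (Function.update (Function.update w s(z, y) 0) s(y, t) 0) q ∅ ω *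
            ind {ω : BondConfig V | ω \ {s(z, y), s(y, t)} ∈ (openConn z t : Set (BondConfig V))} ω +
        ((w s(z, y) : unitInterval) : ℝ) * ((w s(y, t) : unitInterval) : ℝ) * (q⁻¹ * q⁻¹) *
          ∑ ω : BondConfig V, rcWeightW (Function.update (Function.update w s(z, y) 0) s(y, t) 0) q ∅ ω *
            ind {ω : BondConfig V | ω \ {s(z, y), s(y, t)} ∈ (openConn z t : Set (BondConfig V))}ᶜ ω := by
  set K : Set (BondConfig V) := {ω : BondConfig V | ω \ {s(z, y), s(y, t)} ∈ (openConn z t : Set (BondConfig V))} with hK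
  have hKa : ∀ ω : BondConfig V, ω ∆ {s(z, y)} ∈ K ↔ ω ∈ K := apexAvoid_insens z t y (Or.inl rfl)
  have hKb : ∀ ω : BondConfig V, ω ∆ {s(y, t)} ∈ K ↔ ω ∈ K := apexAvoid_insens z t y (Or.inr rfl)
  have hKca : ∀ ω : BondConfig V, ω ∆ {s(z, y)} ∈ Kᶜ ↔ ω ∈ Kᶜ := apexAvoid_compl_insens z t y (Or.inl rfl)
  have hKcb : ∀ ω : BondConfig V, ω ∆ {s(y, t)} ∈ Kᶜ ↔ ω ∈ Kᶜ := apexAvoid_compl_insens z t y (Or.inr rfl)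
  have hsplit := sum_rcWeightW_ind_inter_compl w q (openConn z t : Set (BondConfig V)) K
  have hinK : ∑ ω : BondConfig V, rcWeightW w q ∅ ω * ind ((openConn z t : Set (BondConfig V)) ∩ K) ω =
      ∑ ω : BondConfig V, rcWeightW w q ∅ ω * ind K ω := by
    refine sum_rcWeightW_ind_congr_ae _ q fun ω hω => ?_
    have hapex := apex_of_rcWeightW_ne_zero _ q hyz hyt hw hω
    rw [Set.mem_inter_iff, mem_openConn_iff', reachable_uv_apex_iff hyz hyt hapex, hK, Set.mem_setOf_eq, mem_openConn_iff']
    exact ⟨fun h => h.2, fun h => ⟨Or.inl h, h⟩⟩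
  have hoffK : ∑ ω : BondConfig V, rcWeightW w q ∅ ω * ind ((openConn z t : Set (BondConfig V)) ∩ Kᶜ) ω =
      ∑ ω : BondConfig V, rcWeightW w q ∅ ω * ind ({ω | s(z, y) ∈ ω} ∩ ({ω | s(y, t) ∈ ω} ∩ Kᶜ)) ω := by
    refine sum_rcWeightW_ind_congr_ae _ q fun ω hω => ?_
    have hapex := apex_of_rcWeightW_ne_zero _ q hyz hyt hw hω
    rw [Set.mem_inter_iff, mem_openConn_iff', reachable_uv_apex_iff hyz hyt hapex, Set.mem_inter_iff, Set.mem_inter_iff,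
      Set.mem_compl_iff, hK, Set.mem_setOf_eq, mem_openConn_iff', Set.mem_setOf_eq, Set.mem_setOf_eq]
    tauto
  have hA1 := apex_mass w hq hyz hyt hzt hw K hKa hKb
  have hA3 := apex_mass_ab_inter w hq hyz hyt hzt hw Kᶜ hKca hKcb
  rw [Set.inter_self] at hA1
  rw [← Set.compl_union, Set.union_self] at hA3
  have h := hsplit
  rw [hinK, hoffK, hA1, hA3] at h
  linear_combination (-1 : ℝ) * h

/-- **Triangle level, `{z ↔ y} ∖ {z ↔ t}`**: `S_w(z ↔ y, z ↮ t) = w_c(1−w_d)q⁻¹·B`. [cite: Grimmett2006, Thm. (3.1)(a) (p. 37)] -/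
theorem tri_mass_zy_not_zt (w : Sym2 V → unitInterval) {q : ℝ} (hq : q ≠ 0) {z t y : V} (hyz : y ≠ z) (hyt : y ≠ t)
    (hzt : z ≠ t) (hw : ∀ e : Sym2 V, y ∈ e → ((w e : unitInterval) : ℝ) ≠ 0 → z ∈ e ∨ t ∈ e) :
    ∑ ω : BondConfig V, rcWeightW w q ∅ ω * ind ((openConn z y : Set (BondConfig V)) ∩ (openConn z t : Set (BondConfig V))ᶜ) ω =
      ((w s(z, y) : unitInterval) : ℝ) * (1 - ((w s(y, t) : unitInterval) : ℝ)) * q⁻¹ *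
        ∑ ω : BondConfig V, rcWeightW (Function.update (Function.update w s(z, y) 0) s(y, t) 0) q ∅ ω *
          ind {ω : BondConfig V | ω \ {s(z, y), s(y, t)} ∈ (openConn z t : Set (BondConfig V))}ᶜ ω := by
  set K : Set (BondConfig V) := {ω : BondConfig V | ω \ {s(z, y), s(y, t)} ∈ (openConn z t : Set (BondConfig V))} with hK
  have hKca : ∀ ω : BondConfig V, ω ∆ {s(z, y)} ∈ Kᶜ ↔ ω ∈ Kᶜ := apexAvoid_compl_insens z t y (Or.inl rfl)
  have hKcb : ∀ ω : BondConfig V, ω ∆ {s(y, t)} ∈ Kᶜ ↔ ω ∈ Kᶜ := apexAvoid_compl_insens z t y (Or.inr rfl)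
  -- a.s. `{z ↔ y} ∖ {z ↔ t} = J_c ∩ Kᶜ ∖ (J_c ∩ J_d ∩ Kᶜ)`
  have h1 : ∑ ω : BondConfig V, rcWeightW w q ∅ ω *
      ind ((openConn z y : Set (BondConfig V)) ∩ (openConn z t : Set (BondConfig V))ᶜ) ω =
      ∑ ω : BondConfig V, rcWeightW w q ∅ ω * ind (({ω | s(z, y) ∈ ω} ∩ Kᶜ) ∩ {ω | s(y, t) ∈ ω}ᶜ) ω := by
    refine sum_rcWeightW_ind_congr_ae _ q fun ω hω => ?_
    have hapex := apex_of_rcWeightW_ne_zero _ q hyz hyt hw hω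
    rw [Set.mem_inter_iff, Set.mem_compl_iff, mem_openConn_iff', mem_openConn_iff', reachable_ux_apex_iff hyz hyt hapex,
      reachable_uv_apex_iff hyz hyt hapex, Set.mem_inter_iff, Set.mem_inter_iff, Set.mem_compl_iff, Set.mem_compl_iff, hK,
      Set.mem_setOf_eq, Set.mem_setOf_eq, Set.mem_setOf_eq, mem_openConn_iff']
    tauto
  have h2 := sum_rcWeightW_ind_inter_compl w q ({ω | s(z, y) ∈ ω} ∩ Kᶜ) {ω | s(y, t) ∈ ω}
  have h3 : ∑ ω : BondConfig V, rcWeightW w q ∅ ω * ind (({ω | s(z, y) ∈ ω} ∩ Kᶜ) ∩ {ω | s(y, t) ∈ ω}) ω =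
      ∑ ω : BondConfig V, rcWeightW w q ∅ ω * ind ({ω | s(z, y) ∈ ω} ∩ ({ω | s(y, t) ∈ ω} ∩ Kᶜ)) ω := by
    refine sum_rcWeightW_ind_congr_ae _ q fun ω _ => ?_
    simp only [Set.mem_inter_iff]; tauto
  have hA4 := apex_mass_a_inter w hq hyz hyt hzt hw Kᶜ hKca hKcb
  have hA3 := apex_mass_ab_inter w hq hyz hyt hzt hw Kᶜ hKca hKcb
  rw [← Set.compl_union, Set.union_self] at hA3
  have hKK : ∑ ω : BondConfig V, rcWeightW (Function.update (Function.update w s(z, y) 0) s(y, t) 0) q ∅ ω * ind (Kᶜ ∩ K) ω = 0 := by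
    refine Finset.sum_eq_zero fun ω _ => ?_
    have : ω ∉ Kᶜ ∩ K := fun h => h.1 h.2
    rw [ind_of_not_mem this, mul_zero]
  rw [hKK] at hA4
  rw [h1, h2, h3, hA4, hA3]
  ring

/-- **Triangle level, `z ↔ y`**: `S_w(z ↔ y) = w_c(q⁻¹((1−w_d)+w_d q⁻¹)(A+B) − (q⁻¹−1)w_d q⁻¹ A) + w_d q⁻¹ A − w_c w_d q⁻¹ A`.
[cite: Grimmett2006, Thm. (3.1)(a) (p. 37); §1.4 eq. (1.20) (p. 15)] -/
theorem tri_mass_zy (w : Sym2 V → unitInterval) {q : ℝ} (hq : q ≠ 0) {z t y : V} (hyz : y ≠ z) (hyt : y ≠ t) (hzt : z ≠ t)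
    (hw : ∀ e : Sym2 V, y ∈ e → ((w e : unitInterval) : ℝ) ≠ 0 → z ∈ e ∨ t ∈ e) :
    ∑ ω : BondConfig V, rcWeightW w q ∅ ω * ind (openConn z y : Set (BondConfig V)) ω =
      ((w s(z, y) : unitInterval) : ℝ) *
          (q⁻¹ * ((1 - ((w s(y, t) : unitInterval) : ℝ)) + ((w s(y, t) : unitInterval) : ℝ) * q⁻¹) *
              (∑ ω : BondConfig V, rcWeightW (Function.update (Function.update w s(z, y) 0) s(y, t) 0) q ∅ ω *
                  ind {ω : BondConfig V | ω \ {s(z, y), s(y, t)} ∈ (openConn z t : Set (BondConfig V))} ω +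
                ∑ ω : BondConfig V, rcWeightW (Function.update (Function.update w s(z, y) 0) s(y, t) 0) q ∅ ω *
                  ind {ω : BondConfig V | ω \ {s(z, y), s(y, t)} ∈ (openConn z t : Set (BondConfig V))}ᶜ ω) -
            (q⁻¹ - 1) * ((w s(y, t) : unitInterval) : ℝ) * q⁻¹ *
              ∑ ω : BondConfig V, rcWeightW (Function.update (Function.update w s(z, y) 0) s(y, t) 0) q ∅ ω *
                ind {ω : BondConfig V | ω \ {s(z, y), s(y, t)} ∈ (openConn z t : Set (BondConfig V))} ω) +
        (((w s(y, t) : unitInterval) : ℝ) * q⁻¹ - ((w s(z, y) : unitInterval) : ℝ) * ((w s(y, t) : unitInterval) : ℝ) * q⁻¹) *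
          ∑ ω : BondConfig V, rcWeightW (Function.update (Function.update w s(z, y) 0) s(y, t) 0) q ∅ ω *
            ind {ω : BondConfig V | ω \ {s(z, y), s(y, t)} ∈ (openConn z t : Set (BondConfig V))} ω := by
  set K : Set (BondConfig V) := {ω : BondConfig V | ω \ {s(z, y), s(y, t)} ∈ (openConn z t : Set (BondConfig V))} with hK
  have hab := apex_pairs_ne hyz hzt
  have hKa : ∀ ω : BondConfig V, ω ∆ {s(z, y)} ∈ K ↔ ω ∈ K := apexAvoid_insens z t y (Or.inl rfl)
  have hKb : ∀ ω : BondConfig V, ω ∆ {s(y, t)} ∈ K ↔ ω ∈ K := apexAvoid_insens z t y (Or.inr rfl)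
  have hU : ∀ g : Sym2 V, ∀ ω : BondConfig V, ω ∆ {g} ∈ (Set.univ : Set (BondConfig V)) ↔ ω ∈ (Set.univ : Set (BondConfig V)) :=
    fun g ω => by simp
  -- a.s. split `{z ↔ y} = J_c ⊔ (J_cᶜ ∩ J_d ∩ K)`
  have hsplit := sum_rcWeightW_ind_inter_compl w q (openConn z y : Set (BondConfig V)) {ω | s(z, y) ∈ ω}
  have h1 : ∑ ω : BondConfig V, rcWeightW w q ∅ ω * ind ((openConn z y : Set (BondConfig V)) ∩ {ω | s(z, y) ∈ ω}) ω =
      ∑ ω : BondConfig V, rcWeightW w q ∅ ω * ind ({ω | s(z, y) ∈ ω} ∩ Set.univ) ω := by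
    refine sum_rcWeightW_ind_congr_ae _ q fun ω hω => ?_
    have hapex := apex_of_rcWeightW_ne_zero _ q hyz hyt hw hω
    rw [Set.mem_inter_iff, mem_openConn_iff', reachable_ux_apex_iff hyz hyt hapex, Set.inter_univ, Set.mem_setOf_eq]
    tauto
  have h2 : ∑ ω : BondConfig V, rcWeightW w q ∅ ω * ind ((openConn z y : Set (BondConfig V)) ∩ {ω | s(z, y) ∈ ω}ᶜ) ω =
      ∑ ω : BondConfig V, rcWeightW w q ∅ ω * ind (({ω | s(y, t) ∈ ω} ∩ (Set.univ ∩ K)) ∩ {ω | s(z, y) ∈ ω}ᶜ) ω := by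
    refine sum_rcWeightW_ind_congr_ae _ q fun ω hω => ?_
    have hapex := apex_of_rcWeightW_ne_zero _ q hyz hyt hw hω
    rw [Set.mem_inter_iff, mem_openConn_iff', reachable_ux_apex_iff hyz hyt hapex, Set.univ_inter, Set.mem_inter_iff,
      Set.mem_inter_iff, Set.mem_compl_iff, hK, Set.mem_setOf_eq, Set.mem_setOf_eq, Set.mem_setOf_eq]
    tauto
  have h3 := sum_rcWeightW_ind_inter_compl w q ({ω | s(y, t) ∈ ω} ∩ (Set.univ ∩ K)) {ω | s(z, y) ∈ ω}
  have h4 : ∑ ω : BondConfig V, rcWeightW w q ∅ ω * ind (({ω | s(y, t) ∈ ω} ∩ (Set.univ ∩ K)) ∩ {ω | s(z, y) ∈ ω}) ω =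
      ∑ ω : BondConfig V, rcWeightW w q ∅ ω * ind ({ω | s(z, y) ∈ ω} ∩ ({ω | s(y, t) ∈ ω} ∩ K)) ω := by
    refine sum_rcWeightW_ind_congr_ae _ q fun ω _ => ?_
    simp only [Set.mem_inter_iff, Set.univ_inter]; tauto
  have hA4 := apex_mass_a_inter w hq hyz hyt hzt hw Set.univ (hU _) (hU _)
  have hA2 := apex_mass_b_inter w hq hyz hyt hzt hw Set.univ (hU _) (hU _)
  have hA3 := apex_mass_ab_inter w hq hyz hyt hzt hw K hKa hKb
  have hKK : ∑ ω : BondConfig V, rcWeightW (Function.update (Function.update w s(z, y) 0) s(y, t) 0) q ∅ ω * ind (K ∩ Kᶜ) ω = 0 := by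
    refine Finset.sum_eq_zero fun ω _ => ?_
    have : ω ∉ K ∩ Kᶜ := fun h => h.2 h.1
    rw [ind_of_not_mem this, mul_zero]
  have hZ0 := sum_rcWeightW_ind_compl (Function.update (Function.update w s(z, y) 0) s(y, t) 0) q K
  have h := hsplit
  rw [h1, h2, h3, h4, hA4, hA2, hA3, hKK, Set.univ_inter, sum_rcWeightW_ind_univ] at h
  rw [hZ0]
  linear_combination (-1 : ℝ) * h



end FK

end Summit.CriticalPhenomena.PercolationContinuityZ3.Theorems

end
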